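import Summits.HodgeConjecture.HodgeConjecture.Theorems.Ring2WeilCoverageTypeRelativeNormSignLevel56
import Summits.HodgeConjecture.HodgeConjecture.Theorems.Ring2WeilCoverageNonPrincipalLatticeLevel56
import Summits.HodgeConjecture.HodgeConjecture.Theorems.Ring2WeilCoverageLatticeTypeExchange
import Summits.HodgeConjecture.HodgeConjecture.Theorems.Ring2WeilCoverageTypeRelativeNormSignLevel39NonPrincipal
import HarnessLib

/-!
# Weil-type family coverage — THE RELATIVE NORM-SIGN LAW ON THE NON-PRINCIPAL LATTICE CLASS OF `ℤ[ζ₅₆]`: on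
# `ℂ^Φ/Φ(𝔓)`, `𝔓 = (1 − ζ⁷, ζ⁸ + ζ¹⁶ + ζ³²)`, the principal type `(ϖ₀)` occurs iff at EACH real place of `ℚ(√2)` the
# twisted sign count of `Φ` is even exactly when the relative norm `N_{ℚ(ζ₅₆)⁺/ℚ(√2)}(ϖ₀)` is NEGATIVE there —
# part 58d's law with both signs FLIPPED

research route conditional on HC_CM; not a corollary; Q11.4-sentence-2 already refuted in dim ≥ 3.

Ring 2, WEIL-TYPE FAMILY-COVERAGE CENSUS (`HOME/WEIL-FAMILY-COVERAGE.md` `## b01`, blocks b01.39/b01.40 (the index-`2`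
level `56`, `h(ℚ(ζ₅₆)) = 2`: principal polarisability FLIPS between the two lattice classes), b01.42 (the norm-sign law),
b01.44; owner ring2-b01), part 70 of the `Ring2WeilCoverage*` series — the level-`56` twin of part 69.  Part 58d
(`…TypeRelativeNormSignLevel56`) decided every principal type `(ϖ₀)` on the PRINCIPAL torus `ℂ^Φ/Φ(ℤ[ζ₅₆])`; part 46
(`…NonPrincipalLatticeLevel56`) decided principal polarisations on the NON-principal class `𝔓` (`𝔓𝔓^ρ = (α)`,
`α = ζ²⁴(1 − ζ)(1 − ζ⁶³) ∈ ℤ[ζ₅₆]⁺`); part 59 (`…LatticeTypeExchange`) moves types between lattices: «type `(ϖ₀)` on `D(𝔪)`» ⟺ «type `(α₀ϖ₀)` on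
`D(𝔬)`» when `𝔪𝔪^ρ = (α₀)`.  This file composes the three (the general §1 lemmas are part 69's):

* §1 (taken from part 69, any CM field): `re_relNorm_mul` — the relative norm read at a place is multiplicative on
  `𝓞 K⁺`; `re_relNorm_ne_zero`.
* §2 `re_relNorm_alpha_neg` — **`N_{ℚ(ζ₅₆)⁺/ℚ(√2)}(α)` is NEGATIVE at BOTH real places of `ℚ(√2)`**: at the place under
  `φ₀` its sign is the parity of `#{φ ∈ Φ : φ(√2) = φ₀(√2), Re φ(α) < 0}` (part 58), and this count is `3` for every
  CM type `Φ` (part 46 `card_filter_negA_plus/minus`, through the residue dictionaries of parts 13/26b).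
* §3 **`exists_type_span_iff_fiftySix_nonprincipal`** — for every CM type `Φ`, every `ϖ₀ ∈ 𝓞 K⁺ ∖ 0` and every
  lattice `𝔪 = 𝔓`: `ℂ^Φ/D(𝔪)` carries a `Φ`-positive divisor of type `(ϖ₀)` iff
  (`#{φ ∈ Φ : φ(s) = φ₊(s), Im φ(ξ) < 0}` even ⟺ `Re φ₊(N_{K⁺/ℚ(s)}(ϖ₀)) < 0`) and (the same at `φ₋`) — where part 58d
  has `> 0` twice for the principal lattice.  In words: passing from `ℤ[ζ₅₆]` to `𝔓` flips the verdict for EVERY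
  principal type, not only for principal polarisations (b01.40).

HONEST FRAMING: torus-level statements about Shimura's divisors of type `(K; Φ; 𝔣₀)` [Sh98 §14.3 Prop. 4–5, §14.4
Prop. 7]; nothing here is a statement about Hodge classes, `W_K`, general members or HC; `HC_CM` is used nowhere.  No
`def`, no named fact, no `sorry`.

References: [cite: Shimura1998, §14.3 Prop. 4–5, pp. 103–104; §14.4 Prop. 7, p. 105]; census b01.40, b01.44
(seat-derived).
-/

noncomputable section

open scoped Classical nonZeroDivisors NumberField ComplexConjugate
open NumberField NumberField.ComplexEmbedding Module FractionalIdeal Complex Polynomial Finset IntermediateField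

namespace Summit.HodgeConjecture.Ring2WeilCoverage.TypeRelativeNormSignLevel56NonPrincipal

open Literature.AlgebraicGeometry.Motives (CMType)
open Literature.AlgebraicGeometry.HodgeTheory (IsCMTypeSet)
open Literature.AlgebraicGeometry.ComplexMultiplication.CyclotomicCMType
  (exists_apply_eq_toCircle embedding_eq_of_apply_eq isCMTypeSet_residueFilter)
open Literature.NumberTheory.ComplexMultiplication
open Literature.NumberTheory.ComplexMultiplication.CMTypeLattice
open Summit.HodgeConjecture.Ring2WeilCoverage.CMTypeSignParity
open Summit.HodgeConjecture.Ring2WeilCoverage.CMUnitSignature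
open Summit.HodgeConjecture.Ring2WeilCoverage.TypeNormSign
open Summit.HodgeConjecture.Ring2WeilCoverage.TypeRelativeNormSign
open Summit.HodgeConjecture.Ring2WeilCoverage.TypeRelativeNormSignLevel56 (exists_type_span_iff_fiftySix)
open Summit.HodgeConjecture.Ring2WeilCoverage.TwistedUnitSignature (prod_filter_re_embedding_eq_re_norm)
open Summit.HodgeConjecture.Ring2WeilCoverage.CyclotomicTwistedObstruction (apply_eq_apply_iff)
open Summit.HodgeConjecture.Ring2WeilCoverage.CyclotomicTwistedLevel56 (sq_sqrtTwo classes_fiftySix)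
open Summit.HodgeConjecture.Ring2WeilCoverage.ResidueDictionaryPiecesB (re_embedding_sqrtTwo_neg_iff)
open Summit.HodgeConjecture.Ring2WeilCoverage.WeilTypeBalance (ncard_inter_eq_card_filter)
open Summit.HodgeConjecture.Ring2WeilCoverage.CyclotomicPrincipalObstruction (coprime_of_apply_eq_toCircle)
open Summit.HodgeConjecture.Ring2WeilCoverage.NonPrincipalLatticeLevel56
  (alpha_read' alpha_real_ne_zero card_filter_negA_plus card_filter_negA_minus mul_conjIdeal_eq_of_coe_eq)
open Summit.HodgeConjecture.Ring2WeilCoverage.LatticeTypeExchange (exists_pos_isOfType_span_iff_one_span_mul)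
open Summit.HodgeConjecture.Ring2WeilCoverage.TypeRelativeNormSignLevel39NonPrincipal (re_relNorm_mul re_relNorm_ne_zero)

variable {K : Type} [Field K] [NumberField K] [IsCMField K] {ζ : K}

/-- `𝐞(t) = exp(2πi t/56) ∈ ℂ` (`ZMod.toCircle`). -/
local notation3 (prettyPrint := false) "𝐞 " t:max => ((ZMod.toCircle t : Circle) : ℂ)

/-- the census's skew generator `ξ = ζ¹¹/Φ₅₆′(ζ)` (`g = 12`). -/
local notation3 (prettyPrint := false) "ξ" => (ζ ^ 11 * (aeval ζ (derivative (cyclotomic 56 ℚ)))⁻¹)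

/-- the image in `K` of an integer of the maximal real subfield. -/
local notation3 (prettyPrint := false) "𝓇 " x:max => (algebraMap (𝓞 (maximalRealSubfield K)) K x)

/-- `Re φ₀|_{K⁺}(N_{K⁺/ℚ(s)}(x))`. -/
local notation3 (prettyPrint := false) "RN[" φ₀ "," s "] " x:max =>
  (((RingHom.comp (φ₀ : K →+* ℂ) (algebraMap (maximalRealSubfield K) K))
    (algebraMap (ℚ⟮(s : maximalRealSubfield K)⟯) (maximalRealSubfield K)
      (Algebra.norm (ℚ⟮(s : maximalRealSubfield K)⟯) (x : maximalRealSubfield K)))).re)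

/-- «`χ₈(t) = −1`» (`t ≡ ±3 (mod 8)`), part 26b's dictionary predicate for `√2`. -/
local notation3 (prettyPrint := false) "NR8 " t:max =>
  (({1, 7} : Finset (ZMod 8)).image (· * (((ZMod.val t : ℕ) : ℕ) : ZMod 8)) = ({3, 5} : Finset (ZMod 8)))

/-- the class `C₊ = {t : χ₈(t) = +1}` of unit residues mod `56`. -/
local notation3 (prettyPrint := false) "Cp" => ({1, 9, 15, 17, 23, 25, 31, 33, 39, 41, 47, 55} : Finset (ZMod 56))

/-- `√2 ∈ ℚ(ζ₅₆)` as part 26b writes it (`ζ₈ + ζ₈⁻¹`, `ζ₈ = ζ⁷`). -/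
local notation3 (prettyPrint := false) "S2" => ((ζ : K) ^ (56 / 8) + ζ ^ (56 / 8 * 7))

/-- the sign predicate of `α`: `56 < t mod 112 ↔ 56 < 63t mod 112` (part 46). -/
local notation3 (prettyPrint := false) "negA " t:max =>
  (56 < 1 * ZMod.val (t : ZMod 56) % (2 * 56) ↔ 56 < 63 * ZMod.val (t : ZMod 56) % (2 * 56))

/-- `α = ζ²⁴(1 − ζ)(1 − ζ⁶³)` (part 46: `𝔓𝔓^ρ = (α)`). -/
local notation3 (prettyPrint := false) "α" => (ζ ^ 24 * (1 - ζ ^ 1) * (1 - ζ ^ 63))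

/-- the lattice `𝔓 = (1 − ζ⁷, ζ⁸ + ζ¹⁶ + ζ³²) ⊂ 𝓞 K` (part 46). -/
local notation3 (prettyPrint := false) "𝔓[" hζ "]" =>
  (Ideal.span {1 - IsPrimitiveRoot.toInteger hζ ^ 7,
    IsPrimitiveRoot.toInteger hζ ^ 8 + IsPrimitiveRoot.toInteger hζ ^ 16 + IsPrimitiveRoot.toInteger hζ ^ 32} : Ideal (𝓞 K))

/-! ### §1 (part 69) `re_relNorm_mul`, `re_relNorm_ne_zero` — imported -/

/-! ### §2 The relative norm of `α` is negative at both places -/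

variable [IsCyclotomicExtension {56} ℚ K]

/-- **`Re φ₀(N_{K⁺/ℚ(√2)}(α)) < 0` at EVERY place**: for any CM type `Φ` and any embedding `φ₀`, the number of `φ ∈ Φ`
over the place of `φ₀` with `Re φ(α) < 0` is `3` (part 46's counts `|S_Φ ∩ C± ∩ {negA}| = 3` through the dictionaries
`Re φ_t(α) < 0 ↔ negA t` and `φ_t(√2) = φ₀(√2) ↔ (χ₈(t) = χ₈(t₀))`), hence odd, so the relative norm is not positive
(part 58 `re_relNorm_pos_iff_even_ncard_on`) and it is non-zero.
research route conditional on HC_CM; not a corollary; Q11.4-sentence-2 already refuted in dim ≥ 3. [cite: Shimura1998, §14.3 Prop. 4–5, pp. 103–104] -/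
theorem re_relNorm_alpha_neg (hζ : IsPrimitiveRoot ζ 56) (Φ : CMType K) (s : maximalRealSubfield K)
    (hs : (s : K) = S2) (φ₀ : K →+* ℂ) {α₀ : 𝓞 (maximalRealSubfield K)} (hα₀ : 𝓇 α₀ = α) :
    RN[φ₀, s] α₀ < 0 := by
  classical
  have hα0 : α₀ ≠ 0 := by
    intro h
    rw [h, map_zero] at hα₀
    exact (alpha_real_ne_zero hζ).2 hα₀.symm
  -- the dictionary for `√2`
  have hμ : IsPrimitiveRoot (ζ ^ 7) 8 := hζ.pow (by norm_num) (by norm_num)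
  have hs2 : (S2 : K) ^ 2 = ((2 : ℕ) : K) := by
    have := sq_sqrtTwo hμ
    have e : (ζ : K) ^ (56 / 8) + ζ ^ (56 / 8 * 7) = ζ ^ 7 + (ζ ^ 7) ^ 7 := by norm_num; ring
    rw [e, this]; norm_num
  have hdict : ∀ {φ : K →+* ℂ} {t : ZMod 56}, φ ζ = 𝐞 t → t.val.Coprime 56 →
      ((((φ S2).re < 0 ↔ NR8 t) ∧ (φ S2).re ≠ 0) ∧ (φ S2).im = 0) :=
    fun hφ ht => re_embedding_sqrtTwo_neg_iff (n := 56) (by norm_num) hφ ht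
  obtain ⟨t₀, ht₀, hφ₀⟩ := exists_apply_eq_toCircle hζ φ₀
  have hCp := classes_fiftySix.1
  have hS := isCMTypeSet_residueFilter hζ Φ
  -- the count over the place of `φ₀`, in residues, is `3` on either class
  have hPQ : ∀ (φ : K →+* ℂ) (t : ZMod 56), φ ζ = 𝐞 t →
      ((φ S2 = φ₀ S2 ∧ (φ α).re < 0) ↔ ((NR8 t ↔ NR8 t₀) ∧ negA t)) := by
    intro φ t hφ
    have ht : t.val.Coprime 56 := coprime_of_apply_eq_toCircle hζ hφ
    rw [apply_eq_apply_iff hs2 (fun t : ZMod 56 => NR8 t) hdict hφ ht hφ₀ ht₀, alpha_read' φ t ht hφ]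
  have hcount : (Φ.1 ∩ {ψ : K →+* ℂ | ψ (s : K) = φ₀ (s : K) ∧ (ψ (𝓇 α₀)).re < 0}).ncard = 3 := by
    rw [hα₀, hs, ncard_inter_eq_card_filter hζ Φ (fun ψ => ψ S2 = φ₀ S2 ∧ (ψ α).re < 0)
      (fun t => (NR8 t ↔ NR8 t₀) ∧ negA t) hPQ]
    by_cases h0 : NR8 t₀
    · refine Eq.trans ?_ (card_filter_negA_minus hS)
      congr 1
      ext t
      simp only [Finset.mem_filter, Finset.mem_inter, Finset.mem_univ, true_and]
      constructor
      · rintro ⟨hσ, hN, hA⟩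
        obtain ⟨σ, hσΦ, hσt⟩ := hσ
        have ht : t.val.Coprime 56 := coprime_of_apply_eq_toCircle hζ hσt
        exact ⟨⟨⟨σ, hσΦ, hσt⟩, fun hC => ((hCp t ht).mp hC).mp (hN.mpr h0)⟩, hA⟩
      · rintro ⟨⟨hσ, hC⟩, hA⟩
        obtain ⟨σ, hσΦ, hσt⟩ := hσ
        have ht : t.val.Coprime 56 := coprime_of_apply_eq_toCircle hζ hσt
        refine ⟨⟨σ, hσΦ, hσt⟩, ⟨fun _ => h0, fun _ => ?_⟩, hA⟩
        by_contra hN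
        exact hC ((hCp t ht).mpr (iff_false_intro hN))
    · refine Eq.trans ?_ (card_filter_negA_plus hS)
      congr 1
      ext t
      simp only [Finset.mem_filter, Finset.mem_inter, Finset.mem_univ, true_and]
      constructor
      · rintro ⟨hσ, hN, hA⟩
        obtain ⟨σ, hσΦ, hσt⟩ := hσ
        have ht : t.val.Coprime 56 := coprime_of_apply_eq_toCircle hζ hσt
        exact ⟨⟨⟨σ, hσΦ, hσt⟩, (hCp t ht).mpr (iff_false_intro fun hN' => h0 (hN.mp hN'))⟩, hA⟩
      · rintro ⟨⟨hσ, hC⟩, hA⟩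
        obtain ⟨σ, hσΦ, hσt⟩ := hσ
        have ht : t.val.Coprime 56 := coprime_of_apply_eq_toCircle hζ hσt
        have hN : ¬ NR8 t := fun hN => ((hCp t ht).mp hC).mp hN
        exact ⟨⟨σ, hσΦ, hσt⟩, ⟨fun hN' => absurd hN' hN, fun h0' => absurd h0' h0⟩, hA⟩
  -- hence not positive, and non-zero
  have hne := re_relNorm_ne_zero Φ s φ₀ hα0
  have hnot : ¬ 0 < RN[φ₀, s] α₀ := by
    rw [re_relNorm_pos_iff_even_ncard_on Φ s φ₀ hα0, hcount]
    decide
  exact lt_of_le_of_ne (not_lt.mp hnot) hne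

/-! ### §3 The law on the non-principal class `𝔓` -/

/-- **THE RELATIVE NORM-SIGN LAW ON `ℂ^Φ/Φ(𝔓)` AT `56` (both signs flipped).**  For every CM type `Φ` of
`K ⊇ ℚ(ζ₅₆)`, every real `ϖ₀ ∈ 𝓞 K⁺ ∖ 0`, embeddings `φ₊`, `φ₋` reading the two real places of `ℚ(√2)`
(`Re φ₊(s) > 0 > Re φ₋(s)`, `s = √2`), and every invertible lattice `𝔪` equal to `𝔓 = (1 − ζ⁷, ζ⁸ + ζ¹⁶ + ζ³²)`:
**`ℂ^Φ/D(𝔪)` carries a `Φ`-positive divisor of type `(ϖ₀)` iff (`#{φ ∈ Φ : φ(s) = φ₊(s), Im φ(ξ) < 0}` even ⟺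
`Re φ₊(N_{K⁺/ℚ(s)}(ϖ₀)) < 0`) and (`#{φ ∈ Φ : φ(s) = φ₋(s), Im φ(ξ) < 0}` even ⟺ `Re φ₋(N_{K⁺/ℚ(s)}(ϖ₀)) < 0`)** —
part 58d's law on `ℤ[ζ₅₆]` read at the type `(αϖ₀)` (part 59, `𝔓𝔓^ρ = (α)`), with `N(α) < 0` at both places (§2).
research route conditional on HC_CM; not a corollary; Q11.4-sentence-2 already refuted in dim ≥ 3. [cite: Shimura1998, §14.3 Prop. 4–5, pp. 103–104; §14.4 Prop. 7, p. 105] -/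
theorem exists_type_span_iff_fiftySix_nonprincipal (hζ : IsPrimitiveRoot ζ 56) (Φ : CMType K)
    (s : maximalRealSubfield K) (hs : (s : K) = S2) {ϖ₀ : 𝓞 (maximalRealSubfield K)} (hϖ0 : ϖ₀ ≠ 0)
    (φp φm : K →+* ℂ) (hp : 0 < (φp (s : K)).re) (hm : (φm (s : K)).re < 0)
    (𝔪 : (FractionalIdeal (𝓞 K)⁰ K)ˣ)
    (h𝔪 : (𝔪 : FractionalIdeal (𝓞 K)⁰ K) = ((𝔓[hζ] : Ideal (𝓞 K)) : FractionalIdeal (𝓞 K)⁰ K)) :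
    (∃ ζ' : K, IsCMField.complexConj K ζ' = -ζ' ∧ (∀ φ : Φ.1, 0 < (φ.1 ζ').im) ∧
        IsOfType 𝔪 ζ' (Ideal.span {ϖ₀})) ↔
      ((Even ((Φ.1 ∩ {ψ : K →+* ℂ | ψ (s : K) = φp (s : K) ∧ (ψ ξ).im < 0}).ncard) ↔ RN[φp, s] ϖ₀ < 0) ∧
        (Even ((Φ.1 ∩ {ψ : K →+* ℂ | ψ (s : K) = φm (s : K) ∧ (ψ ξ).im < 0}).ncard) ↔ RN[φm, s] ϖ₀ < 0)) := by
  -- `α` is the image of a non-zero real integer `α₀`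
  have hαint : IsIntegral ℤ (α : K) := by
    have hz : IsIntegral ℤ ζ := hζ.isIntegral (by norm_num)
    exact ((hz.pow 24).mul (isIntegral_one.sub (hz.pow 1))).mul (isIntegral_one.sub (hz.pow 63))
  obtain ⟨α₀, hα₀⟩ := (IsCMField.RingOfIntegers.complexConj_eq_self_iff K (⟨α, hαint⟩ : 𝓞 K)).mp
    (alpha_real_ne_zero hζ).1
  have hα₀' : 𝓇 α₀ = α := hα₀
  have hα0 : α₀ ≠ 0 := by
    intro h
    rw [h, map_zero] at hα₀'
    exact (alpha_real_ne_zero hζ).2 hα₀'.symm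
  -- `𝔪𝔪^ρ = (α₀)` and the exchange of part 59
  have h𝔪' : (𝔪 : FractionalIdeal (𝓞 K)⁰ K) * (conjIdeal 𝔪 : FractionalIdeal (𝓞 K)⁰ K) =
      spanSingleton (𝓞 K)⁰ (𝓇 α₀) := by
    rw [hα₀']; exact mul_conjIdeal_eq_of_coe_eq hζ 𝔪 h𝔪
  rw [exists_pos_isOfType_span_iff_one_span_mul Φ 𝔪 hα0 h𝔪' ϖ₀,
    exists_type_span_iff_fiftySix hζ Φ s hs (mul_ne_zero hα0 hϖ0) φp φm hp hm,
    re_relNorm_mul s φp α₀ ϖ₀, re_relNorm_mul s φm α₀ ϖ₀]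
  have hap := re_relNorm_alpha_neg hζ Φ s hs φp hα₀'
  have ham := re_relNorm_alpha_neg hζ Φ s hs φm hα₀'
  have hsign : ∀ {a b : ℝ}, a < 0 → (0 < a * b ↔ b < 0) := fun ha =>
    ⟨fun h => by
      by_contra hb
      exact absurd h (not_lt.mpr (mul_nonpos_of_nonpos_of_nonneg ha.le (not_lt.mp hb))),
      fun hb => mul_pos_of_neg_of_neg ha hb⟩
  rw [hsign hap, hsign ham]

end Summit.HodgeConjecture.Ring2WeilCoverage.TypeRelativeNormSignLevel56NonPrincipal

end
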